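import Mathlib.CategoryTheory.Comma.Over.Basic
import Mathlib.GroupTheory.GroupAction.Defs
import Literature.AnabelianGeometry.SemiGraphs.TemperedVerticial
import Literature.AnabelianGeometry.SemiGraphs.TemperedInductionFibrewise
import Literature.AnabelianGeometry.SemiGraphs.TemperedFunctorialityProofs
import HarnessLib

/-!
# Semi-graphs of anabelioids, §3 (part 5): covering semi-graphs, Proposition 3.6 (v),
# Corollary 3.9 (reconstruction of the underlying semi-graph of anabelioids)

Mochizuki, *Semi-graphs of anabelioids*, Publ. RIMS **42** (2006), §3, manuscript pp. 37–43
[cite: MochizukiSemiAnbd2006, §3 pp.37-43], over the local presentation `ProfiniteSemiGraph`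
(`TemperedCoverings.lean`, `TemperedVerticial.lean`; TODO-merge abc-iut-L3-t1 for the §1–2 notions).

* `CovObj.IsLocallyTrivial` and Remark 3.5.1 (p. 37): locally trivial coverings of `G` "=" graph-
  coverings with countable fibres of the underlying semi-graph (in the presentation a locally
  trivial object IS a family of countable sets with trivial actions glued by bijections along the
  branches, i.e. such a graph-covering — recorded as the definition's dictionary);
* `CovObj.coveringGraph S`, `CovObj.coveringHom S` — the covering of semi-graphs of anabelioids
  `G_S → G` "associated, in a natural way, to any object `S` of `B^cov(G)`" (p. 37, via the §2
  construction p. 23), CONSTRUCTED: the vertices (edges, branches) of `G_S` over `c` are the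
  `Π_c`-orbits of `S_c`, the constituent group at an orbit is the stabiliser of a chosen base point,
  a branch-orbit abuts to the vertex-orbit of the image of its points under the gluing `S_e ≅ b^* S_v`,
  and the branch homomorphism is `b_*` followed by conjugation by a chosen element of `Π_v` carrying
  the glued base point to the base point (Def. 3.5 (i));
* Proposition 3.6 (v) (p. 39) `EtaleOfTemperedCovering`: for `G` coherent and `S` tempered,
  `B^temp(G_S) → B^temp(G)` is étale — typed as `B^temp(G_S) ≌ B^temp(G)_S` (Def. 3.4 (i): étale =
  abstractly equivalent to a slice `T_T → T`); `UniformSplitting` names the one sentence of print's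
  proof (p. 40) that produces the finite étale covering of `G` — typed, not discharged;
* Corollary 3.9 (p. 42) `Cor39`: for connected, countable, quasi-coherent, totally elevated,
  totally estranged, verticially slim GRAPHS of anabelioids, "`B^temp(−)` determines a natural
  bijective correspondence between locally open morphisms `G → H` and quasi-geometric morphisms
  `B^temp(G) → B^temp(H)`" — through charts and Proposition 3.2: locally open morphisms induce
  quasi-geometric homomorphisms of tempered fundamental groups, and every quasi-geometric
  homomorphism is induced, up to conjugation, by a locally open morphism unique on underlying
  semi-graphs.

Deliberately NOT here: Remark 3.5.2 (the full embedding of `B^cov(G)` into the category of totally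
aloof, verticially slim semi-graphs of anabelioids with locally finite étale morphisms over `G` —
needs the §2 category; TODO-merge abc-iut-L3-t1); Remark 3.9.1 ("if `G` is a semi-graph which is not
a graph, then the techniques developed here are not sufficient, in general, to reconstruct the open
edges of `G`" — expository, no statement to type); the compatibility of the equivalence in
Prop. 3.6 (v) with the two structure functors to `B^temp(G)` (recorded, not typed: in this
presentation a morphism of semi-graphs of anabelioids records its 2-cells only as `∃ g`, so the
pull-back functor `Hom.covPullback` depends on chosen conjugators and is canonical only up to the
rigidity of Rmk. 2.4.2). No statement of the paper is strengthened.

Revision v2 (abc-iut-L3-d4, owner of record after the abc-iut-L3-t2 seat ended; audits L1-t10 F1/F2,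
ref-e, rulings ψ/χ/α2): (F1) the v1 predicate `IsCoveringGraphOf S G' F` characterised `G'` only through
orbit sets and stabilisers and ignored the gluings `S.glue`, so that non-isomorphic wirings (a connected
2-cycle versus `G ⊔ G` over a one-vertex-one-loop `G`) both qualified and `EtaleOfTemperedCovering` was
false as typed; the characterisation is SUPERSEDED by the construction `CovObj.coveringGraph` /
`CovObj.coveringHom`, which also pins the conjugacy class of the branch homomorphisms. (F2)
`Hom.Induces` is now the pull-back isomorphism `B^temp(φ) ≅ c_H⁻¹ ⋙ F^* ⋙ c_G` (abc-iut-L3-t10's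
`Hom.btempPullback`), which pins `φ` up to conjugacy; the v1 compatibility with the verticial
homomorphisms is recovered as a theorem (`TemperedFunctorialityHomProofs`). Recorded residue of the
review of (v): print's sentence "it follows from the coherence of `G` that there exists a finite étale
covering `H~ → G` whose pull-back to `G'` splits …" (p. 40) uses an index bound uniform in the component
`c` of `G`; it is typed as the named fact `UniformSplitting` (for finite, or strictly coherent, `G` it
follows from the uniform bound on the number of open subgroups of bounded index).
-/

open CategoryTheory Topology

namespace Literature.AnabelianGeometry.SemiGraphs

namespace ProfiniteSemiGraph

universe u

variable {𝒢 ℋ : ProfiniteSemiGraph.{u}}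

/-! ### Remark 3.5.1: locally trivial coverings -/

/-- A *locally trivial* object of `B^cov(G)` (Def. 2.2 (ii) p. 24 for the associated covering
`G' → G`: "each of its induced morphisms between constituent anabelioids is an isomorphism"): all
the actions of the `Π_v`, `Π_e` on the fibres are trivial. **Remark 3.5.1** (p. 37): "passing to the
underlying morphism of semi-graphs yields an equivalence between the datum of a locally trivial
covering of the semi-graph of anabelioids `G` and the datum of a graph-covering with countable
fibers of the semi-graph `G`" — in this presentation a locally trivial object literally IS a family
of countable sets `S_v`, `S_e` glued by bijections `S_e ≅ S_v` along the abutting branches, i.e. a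
graph-covering of the underlying semi-graph with countable fibres.
[cite: MochizukiSemiAnbd2006, Rmk 3.5.1 p.37] -/
@[mk_iff] structure CovObj.IsLocallyTrivial (S : CovObj 𝒢) : Prop where
  /-- `Π_v` acts trivially on `S_v` -/
  trivial_V : ∀ (v : 𝒢.graph.Vertex) (g : 𝒢.Gv v) (x : (S.SV v).obj.V), (S.SV v).obj.ρ g x = x
  /-- `Π_e` acts trivially on `S_e` -/
  trivial_E : ∀ (e : 𝒢.graph.Edge) (g : 𝒢.Ge e) (x : (S.SE e).obj.V), (S.SE e).obj.ρ g x = x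

/-! ### The covering semi-graph of anabelioids of an object of `B^cov(G)` -/

namespace CovObj

variable (S : CovObj 𝒢)

/-- The gluing `S_e ≅ b^* S_v` along a branch `b` of `e` abutting to `v` carries `Π_e`-orbits of `S_e`
into `Π_v`-orbits of `S_v` (it is `b_*`-equivariant): the incidence map of the covering semi-graph.
[cite: MochizukiSemiAnbd2006, Def 3.5(i) p.37] -/
def glueOrbit (b : 𝒢.graph.Branch) (v : 𝒢.graph.Vertex) (h : 𝒢.graph.abuts b = some v) :
    BTemp.Orbits (S.SE (𝒢.graph.edgeOf b)) → BTemp.Orbits (S.SV v) :=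
  Quot.lift (fun x => BTemp.cl (S.SV v) ((S.glue b v h).hom.hom.hom x)) (by
    rintro x _ ⟨k, rfl⟩
    rw [Literature.AlgebraicGeometry.Frobenioids.QuasiTemperoid.BTempConnected.hom_ρ,
      BTemp.res_obj_ρ_apply, BTemp.cl_ρ])

/-- The coincidence map of the covering semi-graph: a branch-orbit `(b, ω)` abuts to nothing if `b`
does, and to the vertex-orbit `(v, glueOrbit ω)` if `b` abuts to `v` (auxiliary form, by cases on the
value of `𝒢.graph.abuts b`). [cite: MochizukiSemiAnbd2006, Def 3.5(i) p.37] -/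
def coveringAbutsAux (b : 𝒢.graph.Branch) : ∀ o : Option 𝒢.graph.Vertex, 𝒢.graph.abuts b = o →
    BTemp.Orbits (S.SE (𝒢.graph.edgeOf b)) → Option (Σ v : 𝒢.graph.Vertex, BTemp.Orbits (S.SV v))
  | none, _, _ => none
  | some v, h, ω => some ⟨v, S.glueOrbit b v h ω⟩

/-- The underlying semi-graph of the covering `G_S → G` attached to `S ∈ B^cov(G)` (p. 37 via §2
p. 23: "the vertices `v'` (respectively, edges `e'`) of `G'` [over `v`, `e`] are the elements of the
set of connected components", i.e. the `Π_v`-orbits of `S_v`, the `Π_e`-orbits of `S_e`; a branch of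
the edge-orbit `(e, ω)` is a branch `b` of `e` tagged by `ω`, abutting as dictated by the gluing along
`b`). Reducible, so that the fibres `B^temp(Π_{(v,ω)})` unfold to `B^temp(Stab(x_ω))` for instance
resolution. [cite: MochizukiSemiAnbd2006, Def 3.5(i) p.37] -/
@[reducible] def coveringSemiGraph : SemiGraph.{u} where
  Vertex := Σ v : 𝒢.graph.Vertex, BTemp.Orbits (S.SV v)
  Edge := Σ e : 𝒢.graph.Edge, BTemp.Orbits (S.SE e)
  Branch := Σ b : 𝒢.graph.Branch, BTemp.Orbits (S.SE (𝒢.graph.edgeOf b))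
  edgeOf b := ⟨𝒢.graph.edgeOf b.1, b.2⟩
  abuts b := S.coveringAbutsAux b.1 (𝒢.graph.abuts b.1) rfl b.2
  two_branches := by
    rintro ⟨e, ω⟩
    obtain ⟨b₁, b₂, hne, rfl, h₂, hall⟩ := 𝒢.graph.two_branches e
    have hT : BTemp.Orbits (S.SE (𝒢.graph.edgeOf b₁)) = BTemp.Orbits (S.SE (𝒢.graph.edgeOf b₂)) := by
      rw [h₂]
    refine ⟨⟨b₁, ω⟩, ⟨b₂, cast hT ω⟩, fun h => hne (congrArg Sigma.fst h), rfl,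
      Sigma.ext h₂ (cast_heq hT ω), ?_⟩
    rintro ⟨b, ω'⟩ hb
    obtain ⟨hbe, hω⟩ := Sigma.mk.inj_iff.mp hb
    rcases hall b hbe with rfl | rfl
    · exact Or.inl (Sigma.ext rfl hω)
    · exact Or.inr (Sigma.ext rfl (hω.trans (cast_heq hT ω).symm))

/-- The stabiliser of a point of an object of `B^temp(Π)`, `Π` profinite, is compact (it is an open,
hence closed, subgroup). [cite: MochizukiSemiAnbd2006, §3 p.33] -/
theorem compactSpace_stab {G : Type u} [Group G] [TopologicalSpace G] [IsTopologicalGroup G]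
    [CompactSpace G] (X : BTemp G) (x : X.obj.V) : CompactSpace (BTemp.stab X x) :=
  isCompact_iff_compactSpace.mp
    (Subgroup.isClosed_of_isOpen _ (X.property.2 x)).isCompact

/-- If the branch-orbit `(b, ω)` abuts to `(v, ω_v)` in the covering semi-graph then `b` abuts to `v`.
[cite: MochizukiSemiAnbd2006, Def 3.5(i) p.37] -/
theorem abuts_of_coveringAbuts {b : 𝒢.graph.Branch} {ω : BTemp.Orbits (S.SE (𝒢.graph.edgeOf b))}
    {v : 𝒢.graph.Vertex} {ωv : BTemp.Orbits (S.SV v)}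
    (h : S.coveringSemiGraph.abuts ⟨b, ω⟩ = some ⟨v, ωv⟩) : 𝒢.graph.abuts b = some v := by
  have key : ∀ (o : Option 𝒢.graph.Vertex) (ho : 𝒢.graph.abuts b = o),
      S.coveringAbutsAux b o ho ω = some ⟨v, ωv⟩ → 𝒢.graph.abuts b = some v := by
    rintro (_ | w) ho hw
    · exact absurd hw (by simp [coveringAbutsAux])
    · have : w = v := congrArg Sigma.fst (Option.some.inj hw)
      rw [ho, this]
  exact key _ rfl h

/-- ... and `ω_v` is the orbit of the glued points of `ω`. [cite: MochizukiSemiAnbd2006, Def 3.5(i) p.37] -/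
theorem glueOrbit_eq_of_coveringAbuts {b : 𝒢.graph.Branch}
    {ω : BTemp.Orbits (S.SE (𝒢.graph.edgeOf b))} {v : 𝒢.graph.Vertex} {ωv : BTemp.Orbits (S.SV v)}
    (h : S.coveringSemiGraph.abuts ⟨b, ω⟩ = some ⟨v, ωv⟩) :
    S.glueOrbit b v (S.abuts_of_coveringAbuts h) ω = ωv := by
  have key : ∀ (o : Option 𝒢.graph.Vertex) (ho : 𝒢.graph.abuts b = o),
      S.coveringAbutsAux b o ho ω = some ⟨v, ωv⟩ →
        ∀ h' : 𝒢.graph.abuts b = some v, S.glueOrbit b v h' ω = ωv := by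
    rintro (_ | w) ho hw h'
    · exact absurd hw (by simp [coveringAbutsAux])
    · obtain rfl : w = v := congrArg Sigma.fst (Option.some.inj hw)
      exact eq_of_heq (Sigma.mk.inj_iff.mp (Option.some.inj hw)).2
  exact key _ rfl h _

/-- Incidence: the glued base point of the branch-orbit lies in the orbit of the base point of the
vertex-orbit it abuts to — some `g ∈ Π_v` carries the one to the other.
[cite: MochizukiSemiAnbd2006, Def 3.5(i) p.37] -/
theorem exists_conjugator {b : 𝒢.graph.Branch} {ω : BTemp.Orbits (S.SE (𝒢.graph.edgeOf b))}
    {v : 𝒢.graph.Vertex} {ωv : BTemp.Orbits (S.SV v)}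
    (h : S.coveringSemiGraph.abuts ⟨b, ω⟩ = some ⟨v, ωv⟩) :
    ∃ g : 𝒢.Gv v, (S.SV v).obj.ρ g
      ((S.glue b v (S.abuts_of_coveringAbuts h)).hom.hom.hom (Quot.out ω)) = Quot.out ωv := by
  refine (BTemp.cl_eq_cl_iff _ _ _).mp ?_
  calc BTemp.cl (S.SV v) ((S.glue b v (S.abuts_of_coveringAbuts h)).hom.hom.hom (Quot.out ω))
      = S.glueOrbit b v (S.abuts_of_coveringAbuts h) (BTemp.cl _ (Quot.out ω)) := rfl
    _ = S.glueOrbit b v (S.abuts_of_coveringAbuts h) ω := congrArg _ (Quot.out_eq ω)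
    _ = ωv := S.glueOrbit_eq_of_coveringAbuts h
    _ = BTemp.cl (S.SV v) (Quot.out ωv) := (Quot.out_eq ωv).symm

/-- The CHOSEN element `g_{b'} ∈ Π_v` realising the incidence of the branch-orbit `b' = (b, ω)` at the
vertex-orbit `(v, ω_v)`: `g_{b'} · φ_b(pt ω) = pt ω_v`. [cite: MochizukiSemiAnbd2006, Def 3.5(i) p.37] -/
noncomputable def conjugator {b : 𝒢.graph.Branch} {ω : BTemp.Orbits (S.SE (𝒢.graph.edgeOf b))}
    {v : 𝒢.graph.Vertex} {ωv : BTemp.Orbits (S.SV v)}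
    (h : S.coveringSemiGraph.abuts ⟨b, ω⟩ = some ⟨v, ωv⟩) : 𝒢.Gv v :=
  Classical.choose (S.exists_conjugator h)

/-- The defining property of the chosen conjugator. [cite: MochizukiSemiAnbd2006, Def 3.5(i) p.37] -/
theorem conjugator_spec {b : 𝒢.graph.Branch} {ω : BTemp.Orbits (S.SE (𝒢.graph.edgeOf b))}
    {v : 𝒢.graph.Vertex} {ωv : BTemp.Orbits (S.SV v)}
    (h : S.coveringSemiGraph.abuts ⟨b, ω⟩ = some ⟨v, ωv⟩) :
    (S.SV v).obj.ρ (S.conjugator h)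
      ((S.glue b v (S.abuts_of_coveringAbuts h)).hom.hom.hom (Quot.out ω)) = Quot.out ωv :=
  Classical.choose_spec (S.exists_conjugator h)

/-- The branch homomorphism of the covering semi-graph at the branch-orbit `(b, ω)` abutting to
`(v, ω_v)`: `Stab_{Π_e}(pt ω) → Stab_{Π_v}(pt ω_v)`, `k ↦ g_{b'} · b_*(k) · g_{b'}⁻¹` (the §2 recipe:
the constituent anabelioid of `G_S` at an orbit is the corresponding connected component, i.e. the
stabiliser, and the branch morphism is the restriction of `b_*` transported along the incidence).
[cite: MochizukiSemiAnbd2006, Def 3.5(i) p.37] -/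
noncomputable def coveringBrHom {b : 𝒢.graph.Branch} {ω : BTemp.Orbits (S.SE (𝒢.graph.edgeOf b))}
    {v : 𝒢.graph.Vertex} {ωv : BTemp.Orbits (S.SV v)}
    (h : S.coveringSemiGraph.abuts ⟨b, ω⟩ = some ⟨v, ωv⟩) :
    BTemp.stab (S.SE (𝒢.graph.edgeOf b)) (Quot.out ω) →ₜ* BTemp.stab (S.SV v) (Quot.out ωv) where
  toFun k := ⟨S.conjugator h * 𝒢.brHom b v (S.abuts_of_coveringAbuts h) k * (S.conjugator h)⁻¹, by
    change (S.SV v).obj.ρ _ (Quot.out ωv) = Quot.out ωv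
    conv_lhs => rw [← S.conjugator_spec h]
    rw [Literature.AlgebraicGeometry.Frobenioids.QuasiTemperoid.BTempConnected.ρ_mul_apply,
      Literature.AlgebraicGeometry.Frobenioids.QuasiTemperoid.BTempConnected.ρ_mul_apply,
      Literature.AlgebraicGeometry.Frobenioids.QuasiTemperoid.BTempConnected.ρ_inv_apply,
      ← BTemp.res_obj_ρ_apply (𝒢.brHom b v _) (S.SV v),
      ← Literature.AlgebraicGeometry.Frobenioids.QuasiTemperoid.BTempConnected.hom_ρ,
      show (S.SE _).obj.ρ (k : 𝒢.Ge _) (Quot.out ω) = Quot.out ω from k.2]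
    exact S.conjugator_spec h⟩
  map_one' := Subtype.ext (by simp)
  map_mul' k l := Subtype.ext (by
    change S.conjugator h * 𝒢.brHom b v (S.abuts_of_coveringAbuts h)
        ((k : 𝒢.Ge (𝒢.graph.edgeOf b)) * (l : 𝒢.Ge (𝒢.graph.edgeOf b))) * (S.conjugator h)⁻¹ =
      S.conjugator h * 𝒢.brHom b v (S.abuts_of_coveringAbuts h) (k : 𝒢.Ge (𝒢.graph.edgeOf b)) *
          (S.conjugator h)⁻¹ *
        (S.conjugator h * 𝒢.brHom b v (S.abuts_of_coveringAbuts h) (l : 𝒢.Ge (𝒢.graph.edgeOf b)) *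
          (S.conjugator h)⁻¹)
    rw [map_mul]; group)
  continuous_toFun := by
    apply Continuous.subtype_mk
    exact (continuous_const.mul
      ((𝒢.brHom b v _).continuous.comp continuous_subtype_val)).mul continuous_const

/-- **The covering semi-graph of anabelioids `G_S → G` of `S ∈ B^cov(G)`** ([SemiAnbd] §3 p. 37: "we
may associate, in a natural way, to any object of `B^cov(G)` a morphism of countable semi-graphs of
anabelioids `G' → G` [cf. the discussion of §2 following Definition 2.1]"; Def. 3.5 (i): the
"coverings of semi-graphs of anabelioids" are the morphisms so constructed), in the local
presentation: vertex/edge/branch orbits, stabilisers of chosen base points (open subgroups of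
profinite groups: compact, totally disconnected), branch homomorphisms `k ↦ g_{b'} b_*(k) g_{b'}⁻¹`.
The choices (base points, conjugators) change `G_S` only up to isomorphism over `G`. Reducible, so
that `B^temp(Π_{(v,ω)})` is `B^temp(Stab_{Π_v}(x_ω))` for instance resolution.
[cite: MochizukiSemiAnbd2006, Def 3.5(i) p.37] -/
@[reducible] noncomputable def coveringGraph : ProfiniteSemiGraph.{u} where
  graph := S.coveringSemiGraph
  Gv v := BTemp.stab (S.SV v.1) (Quot.out v.2)
  Ge e := BTemp.stab (S.SE e.1) (Quot.out e.2)
  compactSpaceV _ := compactSpace_stab _ _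
  compactSpaceE _ := compactSpace_stab _ _
  brHom b v h := S.coveringBrHom (b := b.1) (ω := b.2) (v := v.1) (ωv := v.2) h

/-- The structure morphism `G_S → G` of the covering semi-graph of anabelioids: orbits go to the
component they live over, the constituent groups are included as the stabilisers they are, and the
compatibility with the branch homomorphisms holds with the chosen conjugators `g_{b'}`.
[cite: MochizukiSemiAnbd2006, Def 3.5(i) p.37] -/
noncomputable def coveringHom : Hom S.coveringGraph 𝒢 where
  base :=
    { vertexMap := fun v => v.1
      edgeMap := fun e => e.1
      branchMap := fun b => b.1
      edgeOf_branchMap := fun _ => rfl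
      branchMap_injOn := fun _ _ he hb => Sigma.ext hb (Sigma.mk.inj_iff.mp he).2
      abuts_branchMap := fun b v h =>
        S.abuts_of_coveringAbuts (b := b.1) (ω := b.2) (v := v.1) (ωv := v.2) h }
  hV v := ContinuousMonoidHom.mk (BTemp.stab (S.SV v.1) (Quot.out v.2)).subtype
    continuous_subtype_val
  hE e := ContinuousMonoidHom.mk (BTemp.stab (S.SE e.1) (Quot.out e.2)).subtype
    continuous_subtype_val
  comm b v h := ⟨S.conjugator (b := b.1) (ω := b.2) (v := v.1) (ωv := v.2) h, fun _ => rfl⟩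

end CovObj

/-! ### Proposition 3.6 (v) -/

/-- **Proposition 3.6 (v)** ([SemiAnbd] §3 p. 39), named fact: "Suppose that `G` is coherent, and
that we are given a tempered covering `G' → G`. Then the resulting morphism of temperoids
`B^temp(G') → B^temp(G)` is étale" — with Definition 3.4 (i) (étale = abstractly equivalent to
`T_T → T`): for `S` a tempered object of `B^cov(G)` and `G_S → G` its covering semi-graph of
anabelioids (`CovObj.coveringGraph`, `CovObj.coveringHom`), `B^temp(G_S)` is equivalent to the slice
`B^temp(G)_S`. The compatibility of the equivalence with the structure functors to `B^temp(G)` is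
recorded, not typed (see the module docstring). [cite: MochizukiSemiAnbd2006, Prop 3.6(v) p.39] -/
def EtaleOfTemperedCovering : Prop :=
  ∀ (𝒢 : ProfiniteSemiGraph.{u}), 𝒢.Prop36Hypotheses → 𝒢.IsCoherent →
    ∀ (S : CovObj 𝒢) (hS : S.IsTempered),
      Nonempty (BTempCat S.coveringGraph ≌ Over (⟨S, hS⟩ : BTempCat 𝒢))

/-- The covering-construction sentence of the proof of Proposition 3.6 (v) ([SemiAnbd] §3 p. 40:
"[we may assume without loss of generality that the covering `H → G'` is finite étale.] But then it
follows from the coherence of `G` [cf. Definition 2.3, (iii)] that there exists a finite étale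
covering `H~ → G` whose pull-back to `G'` splits the restrictions of `H → G'` to each of the `G'_{c'}`
[where `c'` is a component of `G'`]"), named fact, read with the author's component-wise correction of
Def. 3.5 (ii) ([IUTchI] Rmk. 2.5.3 (v)): for `G` as in Proposition 3.6 and coherent, `S` tempered with
covering semi-graph `G_S → G`, and `H` a finite object of `B^cov(G_S)`, every connected component of `H`
is split, constituent by constituent, by the pull-back to `G_S` of some finite object of `B^cov(G)` with
nonempty fibres. Typed separately because the printed argument bounds the relevant indices only
component by component of `G` (uniformly so for finite or strictly coherent `G`).
[cite: MochizukiSemiAnbd2006, Prop 3.6(v) p.40] -/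
def UniformSplitting : Prop :=
  ∀ (𝒢 : ProfiniteSemiGraph.{u}), 𝒢.Prop36Hypotheses → 𝒢.IsCoherent →
    ∀ (S : CovObj 𝒢), S.IsTempered → ∀ (H : CovObj S.coveringGraph), H.IsFinite →
      ∀ p : H.Point, ∃ F : CovObj 𝒢, F.IsFinite ∧ F.HasNonemptyFibres ∧
        ∀ q : H.Point, H.SameComponent p q → (S.coveringHom.covPullback.obj F).SplitsAt H q

/-! ### Corollary 3.9 -/

/-- "`φ : π₁^temp(G) → π₁^temp(H)` is induced by the morphism `F : G → H`" ([SemiAnbd] Prop. 3.6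
(iv) p. 39: `F` "induces a morphism of temperoids `B^temp(G) → B^temp(H)` [by pulling back tempered
coverings]"; Prop. 3.2: morphisms of connected temperoids = continuous outer homomorphisms):
`B^temp(φ)` is isomorphic to the pull-back functor of `F` on tempered coverings transported through the
charts, `c_H⁻¹ ⋙ F^* ⋙ c_G`. This pins `φ` up to `π₁^temp(H)`-conjugacy (`ResIsoResIff`) and IMPLIES the
compatibility with the verticial homomorphisms up to conjugation (which was the v1 rendering; audit
L1-t10 F2, ruling χ: recovered as `ProfiniteSemiGraph.Hom.conj_of_chartPullback_iso`,
`TemperedFunctorialityHomProofs.lean`, abc-iut-L3-t10). [cite: MochizukiSemiAnbd2006, Prop 3.6(iv) p.39] -/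
def Hom.Induces (F : Hom 𝒢 ℋ) (c𝒢 : TemperedPiChart 𝒢) (cℋ : TemperedPiChart ℋ)
    (φ : c𝒢.G →ₜ* cℋ.G) : Prop :=
  Nonempty (cℋ.equiv.inverse ⋙ F.btempPullback ⋙ c𝒢.equiv.functor ≅ BTemp.res φ)

/-- The hypotheses of Corollary 3.9 (p. 42): "connected, countable, quasi-coherent, totally
elevated, totally estranged, verticially slim graphs of anabelioids".
[cite: MochizukiSemiAnbd2006, Cor 3.9 p.42] -/
structure Cor39Hypotheses (𝒢 : ProfiniteSemiGraph.{u}) : Prop extends 𝒢.Prop36Hypotheses where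
  isTotallyEstranged : 𝒢.IsTotallyEstranged
  isGraph : 𝒢.IsGraph

/-- **Corollary 3.9 (Reconstruction of the Underlying Semi-graph of Anabelioids)** ([SemiAnbd] §3
p. 42), named fact: "Let `G`, `H` be connected, countable, quasi-coherent, totally elevated, totally
estranged, verticially slim graphs of anabelioids. Then applying '`B^temp(−)`' determines a natural
bijective correspondence between locally open morphisms of semi-graphs of anabelioids `G → H` and
quasi-geometric morphisms of temperoids `B^temp(G) → B^temp(H)`." Through charts (morphisms of
connected temperoids = continuous outer homomorphisms, Prop. 3.2): (a) a homomorphism induced by a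
locally open morphism is quasi-geometric; (b) every quasi-geometric homomorphism is induced by a
locally open morphism, unique on underlying semi-graphs (the morphism of semi-graphs of anabelioids
itself being determined up to the conjugation indeterminacy of Rmk. 2.4.2).
[cite: MochizukiSemiAnbd2006, Cor 3.9 p.42] -/
def Cor39 : Prop :=
  ∀ (𝒢 ℋ : ProfiniteSemiGraph.{u}), Cor39Hypotheses 𝒢 → Cor39Hypotheses ℋ →
    ∀ (c𝒢 : TemperedPiChart 𝒢) (cℋ : TemperedPiChart ℋ),
      (∀ (F : Hom 𝒢 ℋ), F.IsLocallyOpen → ∀ φ : c𝒢.G →ₜ* cℋ.G, F.Induces c𝒢 cℋ φ →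
        IsQuasiGeometric φ) ∧
      ∀ φ : c𝒢.G →ₜ* cℋ.G, IsQuasiGeometric φ →
        ∃ F : Hom 𝒢 ℋ, F.IsLocallyOpen ∧ F.Induces c𝒢 cℋ φ ∧
          ∀ F' : Hom 𝒢 ℋ, F'.IsLocallyOpen → F'.Induces c𝒢 cℋ φ →
            F'.base.vertexMap = F.base.vertexMap ∧ F'.base.edgeMap = F.base.edgeMap

end ProfiniteSemiGraph

end Literature.AnabelianGeometry.SemiGraphs
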